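import Mathlib
import HarnessLib
import Summits.HubbardSuperconductivity.HubbardSuperconductivity.Theorems.KLProgrammeKLRegimeEngineIsoTupleSmallnessV3
import Summits.HubbardSuperconductivity.HubbardSuperconductivity.Theorems.KLProgrammeKLRegimeEngineV8PairTransferExport5
import Summits.HubbardSuperconductivity.HubbardSuperconductivity.Theorems.KLProgrammeKLRegimeEngineV8E5Share2
import Summits.HubbardSuperconductivity.HubbardSuperconductivity.Theorems.KLProgrammeKLRegimeEngineV8DefsFrU
import Summits.HubbardSuperconductivity.HubbardSuperconductivity.Theorems.KLProgrammeKLRegimeEngineV8TowerCEDefs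

/-!
# K3 ENGINE package, U-level v12 CORE (token #14 core of the rev-11 «G10-MOM» text; plan g21 (R89)/(R92)(4)/(R93), wake AMENDMENTS 8–14 of
# `WAKE-hubbard-kl-k3c2-p1-20260827T2110Z.md`; typed by hubbard-kl-k3c2-p2 g14 on the pen's offer «DefsU12-core», k3c2-p1 lineage keeps U12b)

WHAT.  The BRANCH-INDEPENDENT core of the v2 coupling door at the rev-11 tokens `(G, Q) = (klEngGeo10, klEngQ9c P R)`:

  `klEngU₀12Core P R cc := klEngU₀10 P R cc ⊓ klCUu2 P R (klEngQ7 P R) (klEngQ9c P R) cc ⊓ klE5uM P R ⊓ klIsoMomU klEngGeo10 P R (klEngQ9c P R) cc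
      ⊓ klE4UF klEngGeo10 P R (klEngQ9c P R) cc ⊓ klE5RowsU10 P R ⊓ klCTu5 P R (klEngQ7 P R) (klEngQ9c P R) cc ⊓ klE5FrU klEngGeo10 R
      ⊓ klE5ShareU2 P R (klEngQ9c P R) cc ⊓ klTowerU P R (klEngQ9c P R) cc`

(order = p1b's §P3 instance l.4415 + (R93)'s two G-keyed entries + template r2's class-#3 / tower entries keyed at `klEngQ9c`), one `_le_` projection per entry,
positivity under `P.WF ∧ R.WF2`, the lift chain `≤ klEngU₀10 ≤ klEngU₀9 ≤ klEngU₀3`, and the three class-#6 consumer lines below the core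
(`klE5M_fit_of_le_klEngU₀12Core`, `rowsSmallness_klEng10Q9c_of_le_klEngU₀12Core`, `isoTupleL1AtV17F_klEng10_of_hiso_of_le_klEngU₀12Core`).
Token #14 itself (`klEngU₀12 P R cc := klEngU₀12Core P R cc ⊓ <branch rows: #28 components, klTwoLegMomU, klGridU₀, tower-grid>`) is U12b's (k3c2-p1 lineage,
after the 08-28 18:00Z branch word), exactly as AMENDMENT 6 split U11 into core + U11b.
WHY the two G-keyed entries ((R93) «U12-G-KEYED-ENTRIES»): the deferred thresholds `klE4UF`, `klIsoMomU` are `choose`-opaque functions of `(G, Q)` and the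
stub-(b) closer lines (`engineFirstMoments_flow_of_e4FlowAt`, `isoFirstMomentsAt_flow_of_isoMomFlowAt`) run at the binder's `(G, Q)`; the accumulated-rows
entry reads `G.CF`, which at `klEngGeo10` carries `7·2⁵² + 2¹⁸·klIsoMomC`.
Definitions with bodies + order lemmas; nothing about the model is asserted; nothing asserts superconductivity.
-/

noncomputable section

namespace Summit.HubbardSuperconductivity.HubbardSuperconductivity.Theorems.EngineV8

set_option linter.dupNamespace false -- summit = problem name (single-conjunct summit), D-0017

open Real Finset Literature.MathematicalPhysics.QuantumLattice Literature.Probability.LatticeModels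
open Summit.HubbardSuperconductivity.HubbardSuperconductivity.Theorems.KLRegimeSplit
open Summit.HubbardSuperconductivity.HubbardSuperconductivity.Theorems.KLProgrammeLegKernels
open Summit.HubbardSuperconductivity.HubbardSuperconductivity.Theorems.DispersionFlow

/-! ## §1 The core door -/

/-- **`klEngU₀12Core P R cc`** — the branch-independent core of token #14 at the rev-11 keys: the landed door `klEngU₀10` capped by the class thresholds
read at `(klEngGeo10, klEngQ9c P R)` — class #1 `klCUu2`, class #6 `klE5uM` (fit) and `klIsoMomU` (moment row), class #4 `klE4UF` (re-keyed), the
(c)-E5 rows entry `klE5RowsU10` (re-keyed), class #5 `klCTu5`, the (F)(i) insurance `klE5FrU`, class #3 `klE5ShareU2`, E1's tower `klTowerU`. -/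
def klEngU₀12Core (P : SplitConsts) (R : RenConsts) (cc : ℝ) : ℝ :=
  min (klEngU₀10 P R cc)
    (min (klCUu2 P R (klEngQ7 P R) (klEngQ9c P R) cc)
      (min (klE5uM P R)
        (min (klIsoMomU klEngGeo10 P R (klEngQ9c P R) cc)
          (min (klE4UF klEngGeo10 P R (klEngQ9c P R) cc)
            (min (klE5RowsU10 P R)
              (min (klCTu5 P R (klEngQ7 P R) (klEngQ9c P R) cc)
                (min (klE5FrU klEngGeo10 R)
                  (min (klE5ShareU2 P R (klEngQ9c P R) cc) (klTowerU P R (klEngQ9c P R) cc)))))))))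

section Projections

variable (P : SplitConsts) (R : RenConsts) (cc : ℝ)

/-- **THE #14 LIFT LINE**: `klEngU₀12Core ≤ klEngU₀10` (every `klEngU₀10`-keyed fact rides). -/
theorem klEngU₀12Core_le_klEngU₀10 : klEngU₀12Core P R cc ≤ klEngU₀10 P R cc := min_le_left _ _

/-- Entry 2 (class #1): `klEngU₀12Core ≤ klCUu2 P R (klEngQ7 P R) (klEngQ9c P R) cc`. -/
theorem klEngU₀12Core_le_klCUu2 : klEngU₀12Core P R cc ≤ klCUu2 P R (klEngQ7 P R) (klEngQ9c P R) cc :=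
  (min_le_right _ _).trans (min_le_left _ _)

/-- Entry 3 (class #6 fit): `klEngU₀12Core ≤ klE5uM P R`. -/
theorem klEngU₀12Core_le_klE5uM : klEngU₀12Core P R cc ≤ klE5uM P R :=
  (min_le_right _ _).trans ((min_le_right _ _).trans (min_le_left _ _))

/-- Entry 4 (class #6 moment row): `klEngU₀12Core ≤ klIsoMomU klEngGeo10 P R (klEngQ9c P R) cc`. -/
theorem klEngU₀12Core_le_klIsoMomU : klEngU₀12Core P R cc ≤ klIsoMomU klEngGeo10 P R (klEngQ9c P R) cc :=
  (min_le_right _ _).trans ((min_le_right _ _).trans ((min_le_right _ _).trans (min_le_left _ _)))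

/-- Entry 5 (class #4, RE-KEYED at the tokens): `klEngU₀12Core ≤ klE4UF klEngGeo10 P R (klEngQ9c P R) cc`. -/
theorem klEngU₀12Core_le_klE4UF : klEngU₀12Core P R cc ≤ klE4UF klEngGeo10 P R (klEngQ9c P R) cc :=
  (min_le_right _ _).trans ((min_le_right _ _).trans ((min_le_right _ _).trans ((min_le_right _ _).trans (min_le_left _ _))))

/-- Entry 6 ((c)-E5 rows, RE-KEYED at the tokens): `klEngU₀12Core ≤ klE5RowsU10 P R`. -/
theorem klEngU₀12Core_le_klE5RowsU10 : klEngU₀12Core P R cc ≤ klE5RowsU10 P R :=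
  (min_le_right _ _).trans ((min_le_right _ _).trans ((min_le_right _ _).trans ((min_le_right _ _).trans ((min_le_right _ _).trans
    (min_le_left _ _)))))

/-- Entry 7 (class #5): `klEngU₀12Core ≤ klCTu5 P R (klEngQ7 P R) (klEngQ9c P R) cc`. -/
theorem klEngU₀12Core_le_klCTu5 : klEngU₀12Core P R cc ≤ klCTu5 P R (klEngQ7 P R) (klEngQ9c P R) cc :=
  (min_le_right _ _).trans ((min_le_right _ _).trans ((min_le_right _ _).trans ((min_le_right _ _).trans ((min_le_right _ _).trans
    ((min_le_right _ _).trans (min_le_left _ _))))))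

/-- Entry 8 ((F)(i) insurance): `klEngU₀12Core ≤ klE5FrU klEngGeo10 R`. -/
theorem klEngU₀12Core_le_klE5FrU : klEngU₀12Core P R cc ≤ klE5FrU klEngGeo10 R :=
  (min_le_right _ _).trans ((min_le_right _ _).trans ((min_le_right _ _).trans ((min_le_right _ _).trans ((min_le_right _ _).trans
    ((min_le_right _ _).trans ((min_le_right _ _).trans (min_le_left _ _)))))))

/-- Entry 9 (class #3): `klEngU₀12Core ≤ klE5ShareU2 P R (klEngQ9c P R) cc`. -/
theorem klEngU₀12Core_le_klE5ShareU2 : klEngU₀12Core P R cc ≤ klE5ShareU2 P R (klEngQ9c P R) cc :=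
  (min_le_right _ _).trans ((min_le_right _ _).trans ((min_le_right _ _).trans ((min_le_right _ _).trans ((min_le_right _ _).trans
    ((min_le_right _ _).trans ((min_le_right _ _).trans ((min_le_right _ _).trans (min_le_left _ _))))))))

/-- Entry 10 (E1's tower threshold): `klEngU₀12Core ≤ klTowerU P R (klEngQ9c P R) cc`. -/
theorem klEngU₀12Core_le_klTowerU : klEngU₀12Core P R cc ≤ klTowerU P R (klEngQ9c P R) cc :=
  (min_le_right _ _).trans ((min_le_right _ _).trans ((min_le_right _ _).trans ((min_le_right _ _).trans ((min_le_right _ _).trans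
    ((min_le_right _ _).trans ((min_le_right _ _).trans ((min_le_right _ _).trans (min_le_right _ _))))))))

/-- `klEngU₀12Core ≤ klEngU₀9` (the v1 door rides). -/
theorem klEngU₀12Core_le_klEngU₀9 : klEngU₀12Core P R cc ≤ klEngU₀9 P R cc := (klEngU₀12Core_le_klEngU₀10 P R cc).trans (klEngU₀10_le_klEngU₀9 P R cc)

/-- `klEngU₀12Core ≤ klEngU₀3` (the symbol-layer door rides; so `U ≤ 1`). -/
theorem klEngU₀12Core_le_klEngU₀3 : klEngU₀12Core P R cc ≤ klEngU₀3 P R cc := (klEngU₀12Core_le_klEngU₀10 P R cc).trans (klEngU₀10_le_klEngU₀3 P R cc)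

/-- `klEngU₀12Core ≤ klE4UF klEngGeo8 P R (klEngQ8 P R) cc` (the v2 (E4) entry rides through `klEngU₀10`). -/
theorem klEngU₀12Core_le_klE4UF_klEngGeo8 : klEngU₀12Core P R cc ≤ klE4UF klEngGeo8 P R (klEngQ8 P R) cc :=
  (klEngU₀12Core_le_klEngU₀10 P R cc).trans (klEngU₀10_le_klE4UF P R cc)

variable {P R}

/-- **`0 < klEngU₀12Core P R cc`** under `P.WF`, `R.WF2` (every deferred entry is positive unconditionally; `klE5uM` needs `Klam ≥ 1`, `klE5FrU` needs
`0 ≤ cE4`, `0 ≤ Gfr 0`). -/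
theorem klEngU₀12Core_pos (hP : P.WF) (hR : R.WF2) : 0 < klEngU₀12Core P R cc :=
  lt_min (klEngU₀10_pos_of_WF2 P cc hR)
    (lt_min (klCUu2_pos P R _ _ cc)
      (lt_min (klE5uM_pos hP hR)
        (lt_min (klIsoMomU_pos _ P R _ cc)
          (lt_min (klE4UF_pos _ P R _ cc)
            (lt_min (klE5RowsU10_pos P R)
              (lt_min (klCTu5_pos P R _ _ cc)
                (lt_min (klE5FrU_pos_of_wf klEngGeo10_wf hR) (lt_min (klE5ShareU2_pos P R _ cc) (klTowerU_pos P R _ cc)))))))))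

end Projections

/-! ## §2 The class-#6 consumer lines below the core -/

section Consumers

open Summit.HubbardSuperconductivity.HubbardSuperconductivity.Theorems.KLRegimeSplit

/-- **The class-#6 fit at `klEngGeo10` below the core**: `U ≤ klEngU₀12Core P R cc ⟹ klE5AM + 2·(klE5cM + klE5dM P R·Klam²·U) ≤ klEngGeo10.CF`. -/
theorem klE5M_fit_of_le_klEngU₀12Core {P : SplitConsts} {R : RenConsts} (hP : P.WF) (hR : R.WF2) {cc U : ℝ} (hU : U ≤ klEngU₀12Core P R cc) :
    klE5AM + 2 * (klE5cM + klE5dM P R * P.Klam ^ 2 * U) ≤ klEngGeo10.CF :=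
  klE5M_fit_klEngGeo10 hP hR (hU.trans (klEngU₀12Core_le_klE5uM P R cc))

/-- **Input (III) of the (E5-F)ₙ door at the rev-11 keys below the core** (`0 < U ≤ klEngU₀12Core P R c`, `n ≤ n_β + 1`, `klEngL₄ P R β U ≤ L`). -/
theorem rowsSmallness_klEng10Q9c_of_le_klEngU₀12Core (P : SplitConsts) (R : RenConsts) (hP : P.WF) {c β U : ℝ} (hβ : klBetaMin ≤ β) (hU : 0 < U)
    (hU12 : U ≤ klEngU₀12Core P R c) {n L : ℕ} (hn : n ≤ nScales β + 1) (hL : klEngL₄ P R β U ≤ L) :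
    initDevBar klEngGeo10 U + legDressBarQ2 klEngGeo10 P (klEngQ9c P R) U 0 4 +
        (3 * klEngGeo10.CF * (P.Klam * U) ^ 2 +
          ((klEngGeo10.cloc * P.Klam ^ 2 * (1 - (4 : ℝ) ^ (-klEngGeo10.θ))⁻¹ + 2 * (klEngQ9c P R).CR * P.Klam ^ 3 * |U|) * U ^ 2 +
              ∑ j ∈ range n, (klEngQ9c P R).CL β j / L) +
            7 / 3 * (klEngGeo10.CF * (P.Klam * U) ^ 2) + 20 * ((klEngQ9c P R).CR * ((P.Klam * U) ^ 2 + (P.Klam * |U|) ^ 3)) +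
              4 / 3 * ((klEngQ9c P R).CR * (P.Klam * U) ^ 2)) ≤ U / 2 :=
  rowsSmallness_klEng10Q9c P R hP hβ hU (hU12.trans (klEngU₀12Core_le_klEngU₀10 P R c)) (hU12.trans (klEngU₀12Core_le_klE5RowsU10 P R c)) hn hL

variable {L M : ℕ} [NeZero L] [NeZero M]

/-- **STUB (c) CONJUNCT 4 at the rev-11 tokens below the core** (`1 ≤ n ≤ n_β + 1`): the `hiso` binder at `j = n`, the history, the CURRENT (E2″-F)ₙ and the
single U-row `U ≤ klEngU₀12Core P R c` ⟹ `IsoTupleL1AtV17F L M klEngGeo10 P β U μ n`. -/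
theorem isoTupleL1AtV17F_klEng10_of_hiso_of_le_klEngU₀12Core (P : SplitConsts) (R : RenConsts) (hP : P.WF) (hR : R.WF2) {c μ U β : ℝ}
    (hμ : μ ∈ klWindowC) (hU : 0 < U) (hU12 : U ≤ klEngU₀12Core P R c) (hβ : klBetaMin ≤ β) (hL : klEngL₄ P R β U ≤ L) {n : ℕ} (hn1 : 1 ≤ n)
    (hn : n ≤ nScales β + 1) (hline : IsoTupleLineBAt L M klE5AM klE5cM (klE5dM P R) P β U μ n)
    (hhist : HistP klPredsV17F2 L M klEngGeo10 P (klEngQ9c P R) R β U μ 0 n)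
    (hE2'' : PairValueIncrementAtV17F L M klEngGeo10 P (klEngQ9c P R) β U μ n) :
    IsoTupleL1AtV17F L M klEngGeo10 P β U μ n :=
  isoTupleL1AtV17F_klEng10_of_hiso P R hP hR hμ hU (hU12.trans (klEngU₀12Core_le_klEngU₀10 P R c)) (hU12.trans (klEngU₀12Core_le_klE5uM P R c))
    (hU12.trans (klEngU₀12Core_le_klE5RowsU10 P R c)) hβ hL hn1 hn hline hhist hE2''

end Consumers

end Summit.HubbardSuperconductivity.HubbardSuperconductivity.Theorems.EngineV8

end
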